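import Summits.BirchSwinnertonDyer.Rank1Residual.Supersingular.KuriharaTwistSymbolDist
import Summits.BirchSwinnertonDyer.Rank1Residual.Supersingular.KuriharaTwistSchema
import Literature.NumberTheory.EllipticCurves.KuriharaNumber
import Literature.NumberTheory.EllipticCurves.PAdicLFunctionDistributionHoldsProofs
import Literature.NumberTheory.EllipticCurves.PAdicLFunctionNeZeroProofs
import Literature.NumberTheory.EllipticCurves.KatoKolyvaginPrimes
import Literature.NumberTheory.EllipticCurves.HidaFamilyMembersProofs
import HarnessLib

/-!
# The plus symbol in CRT coordinates III: the bins-to-`δ̃` identity for the TREE's `kuriharaNumber`,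
# and a consistent TWIST RECORD with the true bins certifies `δ̃_n ≢ 0 (mod p)`
# (KERNEL; closes the lane's standing "engine ↔ tree identification" for `Supersingular/*KuriharaTwistRecords*`
# down to ONE hypothesis: the recorded bins are the plus-symbol bins)

Cell `b2b-bsdres`, supersingular family, prover A = unit `b2b-bsdres-x10b` (gen 10).  Topic file.  THEOREMS
ONLY; no definition, no named fact, nothing asserted about any curve, nothing booked; marks unchanged.

HONEST FRAMING (run/shared/lean/b2b/bsd-rank1-residual/, verbatim in every file): the goal of the
cell is to DELETE the COMBINATION-SHAPED residual classes of the Birch–Swinnerton-Dyer formula for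
ALL analytic-rank `≤ 1` elliptic curves over `ℚ` — "full BSD formula for every rank `≤ 1` curve in
class `C`" assembled STRICTLY from published theorems — so that the rank-`≤ 1` remainder becomes
exactly the CONSTRUCTION-SHAPED classes, which are TYPED (missing-input `Prop`s), NOT attempted.
This is not "finishing BSD".

## What this file proves

* Part III `Identity.sum_units_ratModP_ratPlusSymbol_mul_choose_eq` — for ANY `f ∈ S₂(Γ₀(N))` whose
  rational plus symbol `[·]⁺_f` satisfies the Hecke relation with integer eigenvalues `A_ℓ ≡ 2 (mod p^k)` at
  the primes of a square-free `n` and is `p`-integral at all `z/d`, `d ∣ n`: for discrete logarithms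
  `ψ_ℓ : (ℤ/ℓ)ˣ → ℤ/p^k`, bin index `m(a) = (Σ_ℓ ψ_ℓ(a mod ℓ)).val`, `ν = ω(n) < p`, `t ≤ ν`,
  `Σ_{a ∈ (ℤ/n)ˣ} \overline{[a/n]⁺_f}·binom(m(a), t) = [t = ν]·kuriharaNumber f (p^k) n ψ`
  (`KuriharaTwistSymbolDist.sum_units_ratModP_mul_choose_eq` for `P = [·]⁺_f` on the prime-factor
  family of `n`; `1`-periodicity `ratPlusSymbol_add_intCast_eq`).
* Part IV `Identity.hecke_ratPlusSymbol_of_isNewformOf`, `Identity.frobeniusTrace_cast_eq_two`, and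
  `Identity.sum_units_ratModP_ratPlusSymbol_mul_choose_eq_of_isNewformOf` — the identity for the newform
  of `E` at `n ∈ 𝒩_k(E, p)` under `p` odd, `E[p]` irreducible: only the lane consumers' own binders.
* Part V `TwistRecord.moment_eq_sum` (the schema's `foldl` moment is `Σ_j binom(j,t)·bins[j]`) and
  **`TwistRecord.kuriharaNumber_ne_zero_of_consistent`** / **`…_of_isNewformOf`**: a record passing
  `TwistRecord.consistent` with `deltaModP ≠ 0` and `ν < p`, WHOSE BINS ARE THE PLUS-SYMBOL BINS
  (`bins[j] = D·c_∞·Σ_{a : m(a) = j} [a/n]⁺_f`, `j < p` — the hypothesis `hbins`), gives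
  `kuriharaNumber f (p^1) n ψ ≠ 0`: the recheck says `p ∤ e_ν` (`deltaRecomputed = deltaModP ∈ (0,p)`),
  `e_ν = D·c_∞·Σ_a binom(m(a),ν)[a/n]⁺_f` by `hbins` (fibrewise), and `\overline{e_ν} = D·c_∞·δ̃_n` by
  Part III.

## What this changes for the lane's records (said plainly)

Before, a `certL_…` theorem (kernel `decide` on `TwistRecord.nonvanishing`) met the tree's `kuriharaNumber`
only through the lane's "standing engine ↔ tree identification" (bins-to-`δ̃` identity argued in the schema
docstring; proved abstractly for `DistSystem`s by n1011-p09, instance missing).  Now every step from the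
recorded integer bins to `kuriharaNumber f (p^1) n ψ ≠ 0` is a tree theorem and the ONLY non-kernel input
is `hbins` — the recorded integers are `D·c_∞·` the plus-symbol bins — which is what the numerics, the
rounding certificate (`KuriharaTwistRoundingIntegrality.lean`) and the period identification
`Ω⁺_f = c_∞·ω₁` assert; the other hypotheses of the `_of_isNewformOf` form are the consumers' binders.
Surjectivity of `ψ` and primitivity of the recorded roots stay per-pair side conditions, as before.

References: `KuriharaTwistSymbolSystem.lean`, `KuriharaTwistSymbolDist.lean` (this seat); n1011-p09's
`KuriharaTwistIdentity*.lean`, `KuriharaTwistSchema*.lean`; C.-H. Kim, arXiv:2203.12159 §1.2.2, §1.4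
[Kim2022StructureSelmer]; Mazur–Tate 1987 §1.3 [MazurTate1987]; HOME/b2b-bsdres-x10b/X6-KURIHARA.md §10.
-/

/-! ## Part III — the tree's plus symbol and `kuriharaNumber` -/
namespace Summit.BirchSwinnertonDyer.Rank1Residual.Supersingular.KuriharaTwist.Identity

open Literature.NumberTheory.DiophantineGeometry.Dioph (ratModP)
open Literature.NumberTheory.EllipticCurves Literature.NumberTheory.EllipticCurves.ModularForms
open CongruenceSubgroup
open scoped MatrixGroups ModularForm

section Kurihara

variable {N : ℕ} [NeZero N] (f : CuspForm (Gamma0 N) 2) {p : ℕ} [hp : Fact p.Prime] (k : ℕ)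

/-- **THE BINS-TO-`δ̃` IDENTITY FOR THE TREE'S `kuriharaNumber`.**  Let `f ∈ S₂(Γ₀(N))`, `n` square-free,
and suppose the rational plus symbol `[·]⁺_f` satisfies the Hecke relation at every prime `ℓ ∣ n` with an
integer eigenvalue `A_ℓ ≡ 2 (mod p^k)` (for a newform: `intCast_mul_ratPlusSymbol`, `ℓ ∤ N`, Kolyvagin
primes `ℓ ≡ 1`, `a_ℓ ≡ ℓ + 1 (mod p^k)`) and is `p`-integral at every `z/d`, `d ∣ n` (e.g. `E[p]`
irreducible, `gcd(n, N) = 1`: `IsNewformOf.norm_ratPlusSymbol_div_le_one`).  Then for discrete logarithms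
`ψ_ℓ : (ℤ/ℓ)ˣ → ℤ/p^k`, the bin index `m(a) = (Σ_{ℓ∣n} ψ_ℓ(a mod ℓ)).val` and `ν = ω(n) < p`, `t ≤ ν`:
`Σ_{a ∈ (ℤ/n)ˣ} \overline{[a/n]⁺_f}·binom(m(a), t) = [t = ν]·δ_n(ψ)` with `δ_n(ψ) = kuriharaNumber f (p^k) n ψ`
— the binomial moments of the character bins of the plus symbol vanish modulo `p^k` below `ν`, and the
`ν`-th IS the Kurihara number: the identity that `TwistRecord.consistent` / `TwistRecordK.consistent`
re-decide on recorded bins, now a theorem about the tree object.  (`sum_units_ratModP_mul_choose_eq` for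
`P = [·]⁺_f` on the prime-factor family of `n`, `1`-periodicity `ratPlusSymbol_add_intCast_eq`.)
[cite: Kim2022StructureSelmer, §1.4.3 (PDF p. 7)] -/
theorem sum_units_ratModP_ratPlusSymbol_mul_choose_eq {n : ℕ} [NeZero n] (hsq : Squarefree n)
    (A : ℕ → ℤ)
    (hhecke : ∀ ℓ ∈ n.primeFactors, ∀ r : ℚ, (A ℓ : ℚ) * ratPlusSymbol f r =
      ∑ j : Fin ℓ, ratPlusSymbol f ((r + ((j : ℕ) : ℚ)) / (ℓ : ℚ)) + ratPlusSymbol f ((ℓ : ℚ) * r))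
    (hA : ∀ ℓ ∈ n.primeFactors, ((A ℓ : ℤ) : ZMod (p ^ k)) = 2)
    (hint : ∀ d : ℕ, d ∣ n → ∀ z : ℤ, ‖((ratPlusSymbol f ((z : ℚ) / (d : ℚ)) : ℚ) : ℚ_[p])‖ ≤ 1)
    (ψ : (ℓ : ℕ) → (ZMod ℓ)ˣ →* Multiplicative (ZMod (p ^ k)))
    (hν : n.primeFactors.card < p) (t : ℕ) (ht : t ≤ n.primeFactors.card) :
    ∑ a : (ZMod n)ˣ, ratModP (p ^ k) (ratPlusSymbol f ((((a : ZMod n).val : ℕ) : ℚ) / (n : ℚ))) *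
        ((((∑ ℓ ∈ n.primeFactors.attach, Multiplicative.toAdd
            (ψ ℓ.1 (ZMod.unitsMap (Nat.dvd_of_mem_primeFactors ℓ.2) a))).val.choose t : ℕ) :
          ZMod (p ^ k))) =
      if t = n.primeFactors.card then kuriharaNumber f (p ^ k) n ψ else 0 := by
  haveI hF : ∀ i : ↥n.primeFactors, Fact ((i : ℕ)).Prime :=
    fun i => ⟨Nat.prime_of_mem_primeFactors i.2⟩
  have hn : ∏ i : ↥n.primeFactors, (i : ℕ) = n :=
    (Finset.prod_coe_sort n.primeFactors (fun x : ℕ => x)).trans (Nat.prod_primeFactors_of_squarefree hsq)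
  have h := sum_units_ratModP_mul_choose_eq (ι := ↥n.primeFactors) (fun i => (i : ℕ))
    Subtype.val_injective (ratPlusSymbol f) (fun r z => ratPlusSymbol_add_intCast_eq f r z) k
    (fun i => A i) (fun i r => hhecke i i.2 r) (fun i => hA i i.2)
    (fun U b => by
      rw [levelArg_eq_crtInt_div]
      refine hint (levelOf (fun i : ↥n.primeFactors => (i : ℕ)) U) ?_ _
      have h2 : levelOf (fun i : ↥n.primeFactors => (i : ℕ)) U ∣ ∏ i : ↥n.primeFactors, (i : ℕ) :=
        Finset.prod_dvd_prod_of_subset _ _ (fun i : ↥n.primeFactors => (i : ℕ)) (Finset.subset_univ U)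
      exact h2.trans (dvd_of_eq hn))
    hn (fun i => ψ i) (by rwa [Fintype.card_coe]) t (by rwa [Fintype.card_coe])
  rw [Fintype.card_coe] at h
  rw [kuriharaNumber_def]
  simpa [Finset.univ_eq_attach] using h

end Kurihara

end Summit.BirchSwinnertonDyer.Rank1Residual.Supersingular.KuriharaTwist.Identity

/-! ## Part IV — the newform of an elliptic curve at a Kolyvagin level -/
namespace Summit.BirchSwinnertonDyer.Rank1Residual.Supersingular.KuriharaTwist.Identity

open Literature.NumberTheory.DiophantineGeometry.Dioph (ratModP)
open Literature.NumberTheory.EllipticCurves Literature.NumberTheory.EllipticCurves.ModularForms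
open CongruenceSubgroup
open scoped MatrixGroups ModularForm

section Newform

variable {N : ℕ} [NeZero N] {f : CuspForm (Gamma0 N) 2} {p : ℕ} [hp : Fact p.Prime] (k : ℕ)
  {W : WeierstrassCurve ℚ} [W.IsElliptic] [W.IsGloballyMinimal]

/-- **The Hecke relation of `[·]⁺_f` for the newform of `E = W` at a good prime `ℓ`**, eigenvalue `a_ℓ(E)`
(tree: `intCast_mul_ratPlusSymbol`, `a_ℓ(f) = a_ℓ(E)`, `ℓ ∤ N`, Manin–Drinfeld `ratCast_ratPlusSymbol_holds`). [folklore] -/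
theorem hecke_ratPlusSymbol_of_isNewformOf (hf : IsNewformOf W f) {ℓ : ℕ} [hℓ : Fact ℓ.Prime]
    (hgood : W.HasGoodReductionAtPrime ℓ) (r : ℚ) :
    (W.frobeniusTrace ℓ : ℚ) * ratPlusSymbol f r =
      ∑ j : Fin ℓ, ratPlusSymbol f ((r + ((j : ℕ) : ℚ)) / (ℓ : ℚ)) + ratPlusSymbol f ((ℓ : ℚ) * r) :=
  intCast_mul_ratPlusSymbol (p := ℓ) hf.1 hℓ.out (not_dvd_level_of_isNewformOf hf hgood)
    (cuspCoeff_eq_frobeniusTrace_of_isNewformOf_holds hf hgood)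
    (ratCast_ratPlusSymbol_holds hf.1 hf.coeffField_eq_bot) r

omit hp [W.IsElliptic] in
/-- At a Kolyvagin prime of level `k` (`ℓ ≡ 1`, `a_ℓ ≡ ℓ + 1 (mod p^k)`): `a_ℓ ≡ 2 (mod p^k)`. [folklore] -/
theorem frobeniusTrace_cast_eq_two {ℓ : ℕ} (h : Kato.IsKolyvaginPrime W p k ℓ) :
    ((W.frobeniusTrace ℓ : ℤ) : ZMod (p ^ k)) = 2 := by
  have h1 : ((ℓ : ℕ) : ZMod (p ^ k)) = 1 := by
    have := (ZMod.natCast_eq_natCast_iff ℓ 1 (p ^ k)).mpr h.modEq_one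
    simpa using this
  have h2 := (ZMod.intCast_eq_intCast_iff_dvd_sub _ _ (p ^ k)).mpr
    ((Int.ModEq.dvd h.frobeniusTrace_modEq.symm))
  -- h2 : ((ℓ + 1 : ℤ) : ZMod) = (frobeniusTrace : ZMod)
  rw [← h2]
  push_cast
  rw [h1]
  norm_num

/-- **THE BINS-TO-`δ̃` IDENTITY FOR THE NEWFORM OF `E` AT A KOLYVAGIN LEVEL** (`n ∈ 𝒩_k`, `p` odd,
`E[p]` irreducible so that every `[a/d]⁺_f`, `d ∣ n`, is `p`-integral): for `t ≤ ν = ω(n) < p`,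
`Σ_{a ∈ (ℤ/n)ˣ} \overline{[a/n]⁺_f}·binom(m(a), t) = [t = ν]·kuriharaNumber f (p^k) n ψ`.  All hypotheses
are the lane consumers' own binders (`IsNewformOf`, `Kato.IsKolyvaginProduct`, irreducibility).
[cite: Kim2022StructureSelmer, §1.4.3 (PDF p. 7)] -/
theorem sum_units_ratModP_ratPlusSymbol_mul_choose_eq_of_isNewformOf (hf : IsNewformOf W f)
    (hp2 : p ≠ 2) (hirr : W.HasIrreducibleModPGaloisRep p) {n : ℕ} [NeZero n]
    (hn : Kato.IsKolyvaginProduct W p k n)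
    (ψ : (ℓ : ℕ) → (ZMod ℓ)ˣ →* Multiplicative (ZMod (p ^ k)))
    (hν : n.primeFactors.card < p) (t : ℕ) (ht : t ≤ n.primeFactors.card) :
    ∑ a : (ZMod n)ˣ, ratModP (p ^ k) (ratPlusSymbol f ((((a : ZMod n).val : ℕ) : ℚ) / (n : ℚ))) *
        ((((∑ ℓ ∈ n.primeFactors.attach, Multiplicative.toAdd
            (ψ ℓ.1 (ZMod.unitsMap (Nat.dvd_of_mem_primeFactors ℓ.2) a))).val.choose t : ℕ) :
          ZMod (p ^ k))) =
      if t = n.primeFactors.card then kuriharaNumber f (p ^ k) n ψ else 0 := by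
  have hgood : ∀ ℓ ∈ n.primeFactors, ∀ [Fact ℓ.Prime], W.HasGoodReductionAtPrime ℓ :=
    fun ℓ hℓ _ => hasGoodReductionAtPrime_of_not_dvd_conductorNorm W
      (hn.isKolyvaginPrime (Nat.prime_of_mem_primeFactors hℓ) (Nat.dvd_of_mem_primeFactors hℓ)).not_dvd_conductorNorm
  have hcop : Nat.Coprime n N := Nat.coprime_of_dvd fun ℓ hℓp hℓn hℓN => by
    haveI : Fact ℓ.Prime := ⟨hℓp⟩
    have hmem : ℓ ∈ n.primeFactors := Nat.mem_primeFactors.mpr ⟨hℓp, hℓn, NeZero.ne n⟩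
    exact not_dvd_level_of_isNewformOf hf (hgood ℓ hmem) hℓN
  refine sum_units_ratModP_ratPlusSymbol_mul_choose_eq f k hn.squarefree (fun ℓ => W.frobeniusTrace ℓ)
    (fun ℓ hℓ r => ?_) (fun ℓ hℓ => frobeniusTrace_cast_eq_two k (hn.isKolyvaginPrime (Nat.prime_of_mem_primeFactors hℓ)
      (Nat.dvd_of_mem_primeFactors hℓ)))
    (fun d hd z => hf.norm_ratPlusSymbol_div_le_one hp2 hirr (hcop.coprime_dvd_left hd) z) ψ hν t ht
  haveI : Fact ℓ.Prime := ⟨Nat.prime_of_mem_primeFactors hℓ⟩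
  exact hecke_ratPlusSymbol_of_isNewformOf hf (hgood ℓ hℓ) r

end Newform

end Summit.BirchSwinnertonDyer.Rank1Residual.Supersingular.KuriharaTwist.Identity


/-! ## Part V — a CONSISTENT TWIST RECORD whose bins are the plus-symbol bins certifies `δ̃_n ≠ 0` -/
namespace Summit.BirchSwinnertonDyer.Rank1Residual.Supersingular.KuriharaTwist

open Literature.NumberTheory.DiophantineGeometry.Dioph (ratModP)
open Literature.NumberTheory.EllipticCurves Literature.NumberTheory.EllipticCurves.ModularForms
open CongruenceSubgroup Finset
open scoped MatrixGroups ModularForm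
open Summit.BirchSwinnertonDyer.BirchSwinnertonDyer.Theorems (deltaParity_ratModP_sum
  deltaParity_ratModP_intCast_mul)

section Record

/-- The `foldl` defining `TwistRecord.moment`, as a `Finset` sum (general start index). [folklore] -/
theorem foldl_zip_range'_eq (t : ℕ) : ∀ (l : List ℤ) (s : ℕ) (acc : ℤ),
    ((List.range' s l.length).zip l).foldl (fun acc kb => acc + (Nat.choose kb.1 t : ℤ) * kb.2) acc =
      acc + ∑ i ∈ Finset.range l.length, (Nat.choose (s + i) t : ℤ) * l.getD i 0
  | [], s, acc => by simp
  | b :: l, s, acc => by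
    rw [List.length_cons, List.range'_succ, List.zip_cons_cons, List.foldl_cons,
      foldl_zip_range'_eq t l (s + 1), Finset.sum_range_succ']
    simp only [List.getD_cons_zero, List.getD_cons_succ, add_zero]
    have : ∀ i : ℕ, s + 1 + i = s + (i + 1) := fun i => by ring
    simp only [this]
    ring

/-- `r.moment t = Σ_{j < #bins} binom(j, t) · bins[j]`. [folklore] -/
theorem TwistRecord.moment_eq_sum (r : TwistRecord) (t : ℕ) :
    r.moment t = ∑ j ∈ Finset.range r.bins.length, (Nat.choose j t : ℤ) * r.bins.getD j 0 := by
  rw [TwistRecord.moment, List.range_eq_range', foldl_zip_range'_eq]; simp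

variable {N : ℕ} [NeZero N] (f : CuspForm (Gamma0 N) 2)

/-- **A CONSISTENT TWIST RECORD WITH THE TRUE BINS CERTIFIES `δ̃_n ≢ 0`.**  `r` passes the schema's
recheck (`r.consistent`, e.g. from a landed `certL_…` theorem) with `deltaModP ≠ 0` and `ν = #primes < p`;
`f` is a cusp form whose plus symbol has the Hecke relation with eigenvalues `A_ℓ ≡ 2 (mod p)` at the primes
of the square-free level `n = r.n` (`ω(n) = ν`) and is `p`-integral at every `z/d`, `d ∣ n`.  IF the recorded
bins ARE the plus-symbol bins — `bins[j] = D·c_∞·Σ_{a : m(a) = j} [a/n]⁺_f` (`j < p`; `D = r.den`,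
`c_∞ = r.components`, `m(a) = (Σ_ℓ ψ_ℓ(a mod ℓ)).val`) — THEN `kuriharaNumber f (p^1) n ψ ≠ 0`: the recheck
gives `p ∤ e_ν` (`deltaRecomputed = deltaModP ∈ (0, p)`), `hbins` gives
`e_ν = D·c_∞·Σ_a binom(m(a), ν)·[a/n]⁺_f` (fibrewise), and its reduction is `D·c_∞·δ̃_n` by Part III.
[cite: Kim2022StructureSelmer, §1.4.3 (PDF p. 7)] -/
theorem TwistRecord.kuriharaNumber_ne_zero_of_consistent (r : TwistRecord) (hc : r.consistent = true)
    (hδ : 0 < r.deltaModP) [hp : Fact r.p.Prime] (hνp : r.primes.length < r.p) [NeZero r.n]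
    (hsq : Squarefree r.n) (hν : r.n.primeFactors.card = r.primes.length)
    (A : ℕ → ℤ)
    (hhecke : ∀ ℓ ∈ r.n.primeFactors, ∀ x : ℚ, (A ℓ : ℚ) * ratPlusSymbol f x =
      ∑ j : Fin ℓ, ratPlusSymbol f ((x + ((j : ℕ) : ℚ)) / (ℓ : ℚ)) + ratPlusSymbol f ((ℓ : ℚ) * x))
    (hA : ∀ ℓ ∈ r.n.primeFactors, ((A ℓ : ℤ) : ZMod (r.p ^ 1)) = 2)
    (hint : ∀ d : ℕ, d ∣ r.n → ∀ z : ℤ, ‖((ratPlusSymbol f ((z : ℚ) / (d : ℚ)) : ℚ) : ℚ_[r.p])‖ ≤ 1)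
    (ψ : (ℓ : ℕ) → (ZMod ℓ)ˣ →* Multiplicative (ZMod (r.p ^ 1)))
    (hbins : ∀ j < r.p, ((r.bins.getD j 0 : ℤ) : ℚ) = (r.den : ℚ) * (r.components : ℚ) *
      ∑ a ∈ (Finset.univ : Finset (ZMod r.n)ˣ).filter (fun a =>
        (∑ ℓ ∈ r.n.primeFactors.attach, Multiplicative.toAdd
          (ψ ℓ.1 (ZMod.unitsMap (Nat.dvd_of_mem_primeFactors ℓ.2) a))).val = j),
        ratPlusSymbol f ((((a : ZMod r.n).val : ℕ) : ℚ) / (r.n : ℚ))) :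
    kuriharaNumber f (r.p ^ 1) r.n ψ ≠ 0 := by
  have hp1 : r.p ^ 1 = r.p := pow_one r.p
  -- unpack the recheck
  have hc' := hc
  simp only [TwistRecord.consistent, Bool.and_eq_true, decide_eq_true_eq, beq_iff_eq, bne_iff_ne,
    ne_eq, Bool.or_eq_true] at hc'
  obtain ⟨⟨⟨⟨⟨⟨-, hlen⟩, -⟩, -⟩, -⟩, -⟩, hrec⟩ := hc'
  -- (1) `p ∤ e_ν`, from `deltaRecomputed = deltaModP ∈ (0, p)`
  have hM : ¬ (r.p : ℤ) ∣ r.moment r.primes.length := by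
    intro hdvd
    apply Nat.ne_of_gt hδ
    have h0 : (r.moment r.primes.length % (r.p : ℤ)).toNat = 0 := by
      rw [Int.emod_eq_zero_of_dvd hdvd]; rfl
    rw [← hrec, TwistRecord.deltaRecomputed, h0]
    simp
  -- (2) the moment as a rational number, through the bins hypothesis, fibrewise
  have hm_lt : ∀ a : (ZMod r.n)ˣ, (∑ ℓ ∈ r.n.primeFactors.attach, Multiplicative.toAdd
      (ψ ℓ.1 (ZMod.unitsMap (Nat.dvd_of_mem_primeFactors ℓ.2) a))).val < r.p := fun a => by
    have := ZMod.val_lt (∑ ℓ ∈ r.n.primeFactors.attach, Multiplicative.toAdd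
      (ψ ℓ.1 (ZMod.unitsMap (Nat.dvd_of_mem_primeFactors ℓ.2) a)))
    exact lt_of_lt_of_eq this hp1
  have hmomQ : ((r.moment r.primes.length : ℤ) : ℚ) = (r.den : ℚ) * (r.components : ℚ) *
      ∑ a : (ZMod r.n)ˣ, (((∑ ℓ ∈ r.n.primeFactors.attach, Multiplicative.toAdd
        (ψ ℓ.1 (ZMod.unitsMap (Nat.dvd_of_mem_primeFactors ℓ.2) a))).val.choose r.primes.length : ℕ) : ℚ) *
        ratPlusSymbol f ((((a : ZMod r.n).val : ℕ) : ℚ) / (r.n : ℚ)) := by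
    rw [r.moment_eq_sum r.primes.length, hlen, Int.cast_sum]
    simp_rw [Int.cast_mul, Int.cast_natCast]
    rw [show ∑ j ∈ Finset.range r.p, ((j.choose r.primes.length : ℕ) : ℚ) * ((r.bins.getD j 0 : ℤ) : ℚ) =
        ∑ j ∈ Finset.range r.p, (r.den : ℚ) * (r.components : ℚ) *
          ∑ a ∈ (Finset.univ : Finset (ZMod r.n)ˣ).filter (fun a =>
            (∑ ℓ ∈ r.n.primeFactors.attach, Multiplicative.toAdd
              (ψ ℓ.1 (ZMod.unitsMap (Nat.dvd_of_mem_primeFactors ℓ.2) a))).val = j),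
            (((∑ ℓ ∈ r.n.primeFactors.attach, Multiplicative.toAdd
              (ψ ℓ.1 (ZMod.unitsMap (Nat.dvd_of_mem_primeFactors ℓ.2) a))).val.choose r.primes.length : ℕ) :
                ℚ) * ratPlusSymbol f ((((a : ZMod r.n).val : ℕ) : ℚ) / (r.n : ℚ)) from
      Finset.sum_congr rfl fun j hj => by
        rw [hbins j (Finset.mem_range.1 hj), Finset.mul_sum, Finset.mul_sum, Finset.mul_sum]
        refine Finset.sum_congr rfl fun a ha => ?_
        rw [(Finset.mem_filter.1 ha).2]
        ring]
    rw [← Finset.mul_sum, Finset.sum_fiberwise_of_maps_to (fun a _ => Finset.mem_range.2 (hm_lt a))]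
  -- (3) reduce modulo `p` (= `p^1`): `\overline{e_ν} = D·c_∞·δ̃_n`
  have hintn : ∀ a : (ZMod r.n)ˣ, ‖((ratPlusSymbol f ((((a : ZMod r.n).val : ℕ) : ℚ) / (r.n : ℚ)) : ℚ) :
      ℚ_[r.p])‖ ≤ 1 := fun a => by
    have := hint r.n (dvd_refl r.n) ((a : ZMod r.n).val : ℤ)
    push_cast at this
    exact this
  have hid := Identity.sum_units_ratModP_ratPlusSymbol_mul_choose_eq f 1 hsq A hhecke hA hint ψ
    (by rw [hν]; exact hνp) r.primes.length (by rw [hν])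
  rw [if_pos hν.symm] at hid
  have hsumint : ∀ a : (ZMod r.n)ˣ, ‖(((((∑ ℓ ∈ r.n.primeFactors.attach, Multiplicative.toAdd
        (ψ ℓ.1 (ZMod.unitsMap (Nat.dvd_of_mem_primeFactors ℓ.2) a))).val.choose r.primes.length : ℕ) : ℚ) *
        ratPlusSymbol f ((((a : ZMod r.n).val : ℕ) : ℚ) / (r.n : ℚ)) : ℚ) : ℚ_[r.p])‖ ≤ 1 := fun a => by
    have := Summit.BirchSwinnertonDyer.BirchSwinnertonDyer.Theorems.deltaParity_norm_intCast_mul_le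
      (((∑ ℓ ∈ r.n.primeFactors.attach, Multiplicative.toAdd
        (ψ ℓ.1 (ZMod.unitsMap (Nat.dvd_of_mem_primeFactors ℓ.2) a))).val.choose r.primes.length : ℕ) : ℤ)
      (hintn a)
    push_cast at this
    exact this
  have hS : ‖((∑ a : (ZMod r.n)ˣ, (((∑ ℓ ∈ r.n.primeFactors.attach, Multiplicative.toAdd
        (ψ ℓ.1 (ZMod.unitsMap (Nat.dvd_of_mem_primeFactors ℓ.2) a))).val.choose r.primes.length : ℕ) : ℚ) *
        ratPlusSymbol f ((((a : ZMod r.n).val : ℕ) : ℚ) / (r.n : ℚ)) : ℚ) : ℚ_[r.p])‖ ≤ 1 :=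
    Summit.BirchSwinnertonDyer.BirchSwinnertonDyer.Theorems.deltaParity_norm_sum_le _ fun a _ => hsumint a
  have hcS := Summit.BirchSwinnertonDyer.BirchSwinnertonDyer.Theorems.deltaParity_norm_intCast_mul_le
    (r.components : ℤ) hS
  have e1 : (r.den : ℚ) * (r.components : ℚ) *
      ∑ a : (ZMod r.n)ˣ, (((∑ ℓ ∈ r.n.primeFactors.attach, Multiplicative.toAdd
        (ψ ℓ.1 (ZMod.unitsMap (Nat.dvd_of_mem_primeFactors ℓ.2) a))).val.choose r.primes.length : ℕ) : ℚ) *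
        ratPlusSymbol f ((((a : ZMod r.n).val : ℕ) : ℚ) / (r.n : ℚ)) =
      ((r.den : ℤ) : ℚ) * (((r.components : ℤ) : ℚ) *
      ∑ a : (ZMod r.n)ˣ, (((∑ ℓ ∈ r.n.primeFactors.attach, Multiplicative.toAdd
        (ψ ℓ.1 (ZMod.unitsMap (Nat.dvd_of_mem_primeFactors ℓ.2) a))).val.choose r.primes.length : ℕ) : ℚ) *
        ratPlusSymbol f ((((a : ZMod r.n).val : ℕ) : ℚ) / (r.n : ℚ))) := by
    push_cast; ring
  have hred : ratModP (r.p ^ 1) ((r.moment r.primes.length : ℤ) : ℚ) =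
      ((r.den : ℤ) : ZMod (r.p ^ 1)) * (((r.components : ℤ) : ZMod (r.p ^ 1)) *
        kuriharaNumber f (r.p ^ 1) r.n ψ) := by
    rw [hmomQ, e1, deltaParity_ratModP_intCast_mul 1 (r.den : ℤ) hcS,
      deltaParity_ratModP_intCast_mul 1 (r.components : ℤ) hS,
      deltaParity_ratModP_sum 1 _ (fun a _ => hsumint a), ← hid]
    congr 2
    refine Finset.sum_congr rfl fun a _ => ?_
    have e2 : ((((∑ ℓ ∈ r.n.primeFactors.attach, Multiplicative.toAdd
          (ψ ℓ.1 (ZMod.unitsMap (Nat.dvd_of_mem_primeFactors ℓ.2) a))).val.choose r.primes.length : ℕ) : ℚ))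
        = ((((∑ ℓ ∈ r.n.primeFactors.attach, Multiplicative.toAdd
          (ψ ℓ.1 (ZMod.unitsMap (Nat.dvd_of_mem_primeFactors ℓ.2) a))).val.choose r.primes.length : ℕ) : ℤ) :
            ℚ) := by
      norm_cast
    rw [e2, deltaParity_ratModP_intCast_mul 1 _ (hintn a)]
    push_cast
    ring
  -- (4) conclude: `\overline{e_ν} ≠ 0`
  intro hzero
  apply hM
  have h := hred
  rw [hzero, mul_zero, mul_zero, Literature.NumberTheory.EllipticCurves.ratModP_intCast,
    ZMod.intCast_zmod_eq_zero_iff_dvd] at h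
  simpa [hp1] using h

end Record

end Summit.BirchSwinnertonDyer.Rank1Residual.Supersingular.KuriharaTwist

namespace Summit.BirchSwinnertonDyer.Rank1Residual.Supersingular.KuriharaTwist

open Literature.NumberTheory.DiophantineGeometry.Dioph (ratModP)
open Literature.NumberTheory.EllipticCurves Literature.NumberTheory.EllipticCurves.ModularForms
open CongruenceSubgroup Finset
open scoped MatrixGroups ModularForm

section RecordNewform

variable {N : ℕ} [NeZero N] {f : CuspForm (Gamma0 N) 2}
  {W : WeierstrassCurve ℚ} [W.IsElliptic] [W.IsGloballyMinimal]

/-- **A CONSISTENT TWIST RECORD OF THE NEWFORM OF `E` AT A KOLYVAGIN LEVEL CERTIFIES `δ̃_n ≢ 0 (mod p)`**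
— the lane consumers' hypothesis `hδ : kuriharaNumber f (p^1) n ψ ≠ 0` — from the record's recheck
(`r.consistent`, `0 < deltaModP`, `ν < p`), `n = r.n ∈ 𝒩_1(E, p)` with `ω(n) = ν`, `p` odd, `E[p]`
irreducible, `f` the newform of `E`, and the ONE identification hypothesis `hbins`; Hecke relation,
`a_ℓ ≡ 2`, `p`-integrality and the bins-to-`δ̃` identity are tree theorems.
[cite: Kim2022StructureSelmer, §1.4.3 (PDF p. 7)] -/
theorem TwistRecord.kuriharaNumber_ne_zero_of_consistent_of_isNewformOf (r : TwistRecord)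
    (hc : r.consistent = true) (hδ : 0 < r.deltaModP) [hp : Fact r.p.Prime] (hνp : r.primes.length < r.p)
    [NeZero r.n] (hν : r.n.primeFactors.card = r.primes.length)
    (hf : IsNewformOf W f) (hp2 : r.p ≠ 2) (hirr : W.HasIrreducibleModPGaloisRep r.p)
    (hn : Kato.IsKolyvaginProduct W r.p 1 r.n)
    (ψ : (ℓ : ℕ) → (ZMod ℓ)ˣ →* Multiplicative (ZMod (r.p ^ 1)))
    (hbins : ∀ j < r.p, ((r.bins.getD j 0 : ℤ) : ℚ) = (r.den : ℚ) * (r.components : ℚ) *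
      ∑ a ∈ (Finset.univ : Finset (ZMod r.n)ˣ).filter (fun a =>
        (∑ ℓ ∈ r.n.primeFactors.attach, Multiplicative.toAdd
          (ψ ℓ.1 (ZMod.unitsMap (Nat.dvd_of_mem_primeFactors ℓ.2) a))).val = j),
        ratPlusSymbol f ((((a : ZMod r.n).val : ℕ) : ℚ) / (r.n : ℚ))) :
    kuriharaNumber f (r.p ^ 1) r.n ψ ≠ 0 := by
  have hgood : ∀ ℓ ∈ r.n.primeFactors, ∀ [Fact ℓ.Prime], W.HasGoodReductionAtPrime ℓ :=
    fun ℓ hℓ _ => hasGoodReductionAtPrime_of_not_dvd_conductorNorm W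
      (hn.isKolyvaginPrime (Nat.prime_of_mem_primeFactors hℓ)
        (Nat.dvd_of_mem_primeFactors hℓ)).not_dvd_conductorNorm
  have hcop : Nat.Coprime r.n N := Nat.coprime_of_dvd fun ℓ hℓp hℓn hℓN => by
    haveI : Fact ℓ.Prime := ⟨hℓp⟩
    have hmem : ℓ ∈ r.n.primeFactors := Nat.mem_primeFactors.mpr ⟨hℓp, hℓn, NeZero.ne r.n⟩
    exact not_dvd_level_of_isNewformOf hf (hgood ℓ hmem) hℓN
  refine r.kuriharaNumber_ne_zero_of_consistent f hc hδ hνp hn.squarefree hν (fun ℓ => W.frobeniusTrace ℓ)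
    (fun ℓ hℓ x => ?_)
    (fun ℓ hℓ => Identity.frobeniusTrace_cast_eq_two 1 (hn.isKolyvaginPrime (Nat.prime_of_mem_primeFactors hℓ)
      (Nat.dvd_of_mem_primeFactors hℓ)))
    (fun d hd z => hf.norm_ratPlusSymbol_div_le_one hp2 hirr (hcop.coprime_dvd_left hd) z) ψ hbins
  haveI : Fact ℓ.Prime := ⟨Nat.prime_of_mem_primeFactors hℓ⟩
  exact Identity.hecke_ratPlusSymbol_of_isNewformOf hf (hgood ℓ hℓ) x

end RecordNewform

end Summit.BirchSwinnertonDyer.Rank1Residual.Supersingular.KuriharaTwist
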